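import Summits.NavierStokesRegularity.NavierStokesRegularity.Theorems.AdaptedFrequencyTangentFlowTransferKernelExtract
import Literature.Analysis.FluidPDE.HolderExtraction
import HarnessLib

/-!
# Crux `AdaptedFrequencyConverges` (stmt-NavierStokesRegularity-10493), line `birkhoff-recurrent-hull`:
  stub `stub_pinchedHullRecurrence`, part 1 — joint equicontinuity of adapted kernels of Type-I drifts

Helper file (`--supports` the crux item; stub-worker of lead prover-line-stmt-NavierStokesRegularity-10493-c4-0).

The Birkhoff recurrence of pinched Type-I ancient mild PAIRS `(W, K)` is run in the topology of
uniform convergence of both components on the compact slab pieces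
`[−(n+2), −1/(n+2)] × B̄(0, n+2)`; the tree's kernel stability (`kernelStability`) delivers only
POINTWISE convergence of the kernels, and this file supplies the upgrade:

* `adaptedKernel_slabPiece_modulus` — a modulus of JOINT continuity on each slab piece for an adapted
  backward kernel `G` (unit viscosity, pole `(0,0)`, time set `(−∞,0)`) of a smooth divergence-free
  drift with the Type-I bound `‖b(t,x)‖ ≤ C₀/√(−t)`, under a Gaussian upper bound with constants
  `(C₁, C₂)`: the radius depends on the kernel ONLY through `(C₀, C₁, C₂, n, ε)`.  Space: the tree's
  interior Lipschitz estimate `kernelLimit_space_modulus` (Ishii–Lions, `DriftHeatInteriorLipschitz`);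
  time: the pairings `t ↦ ∫ψG(t)` with a translated bump `ψ` are Lipschitz with a constant depending
  only on the drift bound (`kernelLimit_pairing_lipschitz`), and a bump concentrated at scale of the
  spatial modulus converts this into a modulus of the point values (`kernelLimit_abs_integral_mul_sub_le`).
* `tendstoUniformlyOn_of_uniform_modulus` — Arzelà–Ascoli in the form used: on a compact set, a
  sequence with a common modulus of continuity that converges pointwise converges uniformly;
  `tendstoUniformlyOn_slabPiece_of_adaptedKernels` combines the two for sequences of such kernels.
-/

noncomputable section

-- the summit and its single problem share the name (D-0017 nested layout)
set_option linter.dupNamespace false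

namespace Summit.NavierStokesRegularity.NavierStokesRegularity.Theorems.AdaptedFrequencyConverges.BirkhoffRecurrentHull

open scoped Topology Laplacian ContDiff
open Literature.Analysis Literature.Analysis.FluidPDE Set Filter MeasureTheory Function Metric
open Summit.NavierStokesRegularity.NavierStokesRegularity.Theorems.AdaptedKernelExists.NashEntropyLastBlock

/-! ### Translated bumps -/

/-- Translation invariance of the Laplacian: `Δ(f(· + a))(x) = (Δf)(x + a)` (Mathlib
`iteratedFDeriv_comp_add_right`). [folklore] -/
theorem laplacian_comp_add_right (f : (EuclideanSpace ℝ (Fin 3)) → ℝ) (a x : (EuclideanSpace ℝ (Fin 3))) :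
    (Δ (fun y => f (y + a))) x = (Δ f) (x + a) := by
  rw [InnerProductSpace.laplacian_eq_iteratedFDeriv_stdOrthonormalBasis,
    InnerProductSpace.laplacian_eq_iteratedFDeriv_stdOrthonormalBasis]
  simp only [iteratedFDeriv_comp_add_right]

/-- **Arzelà–Ascoli, the half used here**: on a compact set `K` of a pseudo-metric space, a
sequence of real functions with a COMMON modulus of continuity on `K` which converges pointwise on
`K` converges uniformly on `K` (finite `δ`-net, the limit inherits the modulus). [folklore] -/
theorem tendstoUniformlyOn_of_uniform_modulus {X : Type*} [PseudoMetricSpace X] {K : Set X}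
    (hK : IsCompact K) {F : ℕ → X → ℝ} {f : X → ℝ}
    (hmod : ∀ ε : ℝ, 0 < ε → ∃ δ : ℝ, 0 < δ ∧
      ∀ j, ∀ z ∈ K, ∀ z' ∈ K, dist z z' ≤ δ → |F j z - F j z'| ≤ ε)
    (hpt : ∀ z ∈ K, Tendsto (fun j => F j z) atTop (𝓝 (f z))) :
    TendstoUniformlyOn F f atTop K := by
  rw [Metric.tendstoUniformlyOn_iff]
  intro ε hε
  obtain ⟨δ, hδ, hmodδ⟩ := hmod (ε / 4) (by positivity)
  obtain ⟨T, hTK, hTfin, hcover⟩ := hK.finite_cover_balls hδ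
  -- the limit inherits the modulus
  have hfmod : ∀ z ∈ K, ∀ z' ∈ K, dist z z' ≤ δ → |f z - f z'| ≤ ε / 4 := fun z hz z' hz' hd =>
    le_of_tendsto (((hpt z hz).sub (hpt z' hz')).abs)
      (Eventually.of_forall fun j => hmodδ j z hz z' hz' hd)
  -- eventually every centre of the net is close to its limit
  have hev : ∀ᶠ j in atTop, ∀ c ∈ T, |F j c - f c| < ε / 4 := by
    rw [hTfin.eventually_all]
    intro c hc
    have h := (hpt c (hTK hc)).sub (tendsto_const_nhds (x := f c))
    rw [sub_self] at h
    have h' := (Metric.tendsto_nhds.1 h) (ε / 4) (by positivity)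
    filter_upwards [h'] with j hj
    simpa only [Real.dist_eq, sub_zero] using hj
  filter_upwards [hev] with j hj z hz
  obtain ⟨c, hc, hzc⟩ := mem_iUnion₂.1 (hcover hz)
  rw [mem_ball] at hzc
  have h1 := hmodδ j z hz c (hTK hc) hzc.le
  have h2 := hj c hc
  have h3 := hfmod c (hTK hc) z hz (by rw [dist_comm]; exact hzc.le)
  rw [Real.dist_eq, abs_sub_comm]
  have e : F j z - f z = (F j z - F j c) + (F j c - f c) + (f c - f z) := by ring
  rw [e]
  calc |F j z - F j c + (F j c - f c) + (f c - f z)|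
      ≤ |F j z - F j c + (F j c - f c)| + |f c - f z| := abs_add_le _ _
    _ ≤ |F j z - F j c| + |F j c - f c| + |f c - f z| := by
        gcongr
        exact abs_add_le _ _
    _ < ε := by linarith

/-! ### Joint modulus of continuity of adapted kernels of Type-I drifts -/

/-- **Joint equicontinuity of adapted kernels of Type-I drifts on the slab pieces.** For all
`C₀ ≥ 0`, `C₁, C₂ > 0`, `n`, `ε > 0` there is `δ > 0` such that: for every jointly smooth
divergence-free drift `b` on `(−∞,0) × (EuclideanSpace ℝ (Fin 3))` with `‖b(t,x)‖ ≤ C₀/√(−t)` and every adapted backward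
kernel `G` of `∂ₜ + b·∇ − Δ` on `(−∞, 0)` with pole `(0,0)` and
`G(t,x) ≤ C₁ (−t)^{−3/2} e^{−‖x‖²/(C₂(−t))}`, any two points of the slab piece
`[−(n+2), −1/(n+2)] × B̄(0, n+2)` at distance `≤ δ` have `|G z − G z'| ≤ ε`.  Space: interior
Lipschitz estimate with kernel-independent constants (`stub_kernelLimit_spaceModulus`: drift bound
`C₀ √(2(n+2))`, sup bound `C₁ (2(n+2))^{3/2}` on the blocks `[t, t + 1/(2(n+2))]`); time: Lipschitz
pairings with ONE translated bump at the spatial scale (`kernelLimit_pairing_lipschitz`,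
`kernelLimit_abs_integral_mul_sub_le`). [folklore] -/
theorem adaptedKernel_slabPiece_modulus' {C₀ C₁ C₂ : ℝ} (hC₀ : 0 ≤ C₀) (hC₁ : 0 < C₁) (hC₂ : 0 < C₂)
    (n : ℕ) {ε : ℝ} (hε : 0 < ε) :
    ∃ δ : ℝ, 0 < δ ∧ ∀ (b : ℝ → (EuclideanSpace ℝ (Fin 3)) → (EuclideanSpace ℝ (Fin 3))) (G : ℝ → (EuclideanSpace ℝ (Fin 3)) → ℝ),
      IsSmoothSpaceTimeOn (Iio 0) b → (∀ t ∈ Iio (0:ℝ), VectorCalculus.IsDivFree (b t)) →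
      (∀ t ∈ Iio (0:ℝ), ∀ x, ‖b t x‖ ≤ C₀ / Real.sqrt (-t)) →
      IsAdaptedBackwardKernel 1 b (Iio 0) 0 0 G →
      (∀ t ∈ Iio (0:ℝ), ∀ x, G t x ≤ C₁ * ((0:ℝ) - t) ^ (-(3:ℝ) / 2) *
        Real.exp (-(‖x - (0 : (EuclideanSpace ℝ (Fin 3)))‖ ^ 2) / (C₂ * ((0:ℝ) - t)))) →
      ∀ z ∈ Icc (-((n : ℝ) + 2)) (-(1 / ((n : ℝ) + 2))) ×ˢ closedBall (0 : (EuclideanSpace ℝ (Fin 3))) ((n : ℝ) + 2),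
      ∀ z' ∈ Icc (-((n : ℝ) + 2)) (-(1 / ((n : ℝ) + 2))) ×ˢ closedBall (0 : (EuclideanSpace ℝ (Fin 3))) ((n : ℝ) + 2),
        dist z z' ≤ δ → |G z.1 z.2 - G z'.1 z'.2| ≤ ε := by
  -- ## kernel-independent constants
  set N : ℝ := (n : ℝ) + 2 with hN
  have hN0 : 0 < N := by positivity
  have hN1 : 1 ≤ N := by rw [hN]; linarith [(Nat.cast_nonneg n : (0 : ℝ) ≤ n)]
  set d : ℝ := 1 / (2 * N) with hd
  have hd0 : 0 < d := by positivity
  have hdN : d + d = 1 / N := by rw [hd]; field_simp; ring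
  set Bd : ℝ := C₀ / Real.sqrt d with hBd
  have hBd0 : 0 ≤ Bd := div_nonneg hC₀ (Real.sqrt_nonneg _)
  set M : ℝ := C₁ * d ^ (-(3:ℝ) / 2) with hM
  have hM0 : 0 < M := mul_pos hC₁ (Real.rpow_pos_of_pos hd0 _)
  set ρ : ℝ := Real.sqrt d with hρ
  have hρ0 : 0 < ρ := Real.sqrt_pos.2 hd0
  have hρτ : ρ ^ 2 ≤ 1 * d := by rw [hρ, Real.sq_sqrt hd0.le, one_mul]
  set η : ℝ := ε / 4 with hη
  have hη0 : 0 < η := by positivity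
  -- the spatial radius
  set δx : ℝ := min (lipRad (Bd / 1) ρ) (η / (lipConst (Bd / 1) ρ 3 * M + 1)) with hδx
  have hδx0 : 0 < δx := by
    have hA : 0 ≤ Bd / 1 := by rw [div_one]; exact hBd0
    have h1 : 0 < lipRad (Bd / 1) ρ := lipRad_pos hA hρ0
    have h2 : 0 < lipConst (Bd / 1) ρ 3 := lipConst_pos hA hρ0 (by norm_num)
    exact lt_min h1 (by positivity)
  -- the bump at the origin, at the spatial scale
  let ψb : ContDiffBump (0 : (EuclideanSpace ℝ (Fin 3))) := ⟨δx / 2, δx, by positivity, by linarith⟩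
  set ψ₀ : (EuclideanSpace ℝ (Fin 3)) → ℝ := ⇑ψb with hψ₀def
  have hψ₀2 : ContDiff ℝ 2 ψ₀ := ψb.contDiff
  have hψ₀c : HasCompactSupport ψ₀ := ψb.hasCompactSupport
  have hψ₀0 : ∀ y, 0 ≤ ψ₀ y := fun y => ψb.nonneg
  have hψ₀supp : ∀ y, ψ₀ y ≠ 0 → ‖y‖ < δx := by
    intro y hy
    have : y ∈ support ψ₀ := hy
    rw [hψ₀def, ψb.support_eq] at this
    simpa using this
  obtain ⟨M₁, hM₁⟩ := (hψ₀c.fderiv (𝕜 := ℝ)).exists_bound_of_continuous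
    (hψ₀2.continuous_fderiv two_ne_zero)
  obtain ⟨M₂', hM₂'⟩ := (hψ₀c.iteratedFDeriv 2).exists_bound_of_continuous
    (hψ₀2.continuous_iteratedFDeriv le_rfl)
  have hM₂ : ∀ x, |(Δ ψ₀) x| ≤ 3 * M₂' := by
    intro x
    have h1 := norm_laplacian_le ψ₀ x
    rw [finrank_euclideanSpace_fin] at h1
    rw [← Real.norm_eq_abs]
    refine h1.trans ?_
    have h2 : ‖fderiv ℝ (fderiv ℝ ψ₀) x‖ = ‖iteratedFDeriv ℝ 2 ψ₀ x‖ := by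
      rw [← norm_iteratedFDeriv_fderiv, norm_iteratedFDeriv_one]
    rw [h2]; push_cast
    exact mul_le_mul_of_nonneg_left (hM₂' x) (by norm_num)
  set I₀ : ℝ := ∫ y, ψ₀ y with hI₀
  have hI₀0 : 0 < I₀ := ψb.integral_pos
  -- the time-Lipschitz constant of the pairings
  set A : ℝ := C₀ / Real.sqrt (1 / N) with hA
  have hA0 : 0 ≤ A := div_nonneg hC₀ (Real.sqrt_nonneg _)
  set Lt : ℝ := A * M₁ + 1 * (3 * M₂') with hLt
  -- ## the radius
  refine ⟨min δx (η * I₀ / (|Lt| + 1)), lt_min hδx0 (by positivity), ?_⟩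
  intro b G hb hdiv hbI hG hGb z hz z' hz' hzz'
  -- restriction of the data to the window `[-N-1, 0)`
  have hIco : Ico (-N - 1) 0 ⊆ Iio (0:ℝ) := Ico_subset_Iio_self
  have hb' : IsSmoothSpaceTimeOn (Ico (-N - 1) 0) b := hb.mono hIco
  have hdiv' : ∀ t ∈ Ico (-N - 1) 0, VectorCalculus.IsDivFree (b t) := fun t ht => hdiv t (hIco ht)
  have hG' : IsAdaptedBackwardKernel 1 b (Ico (-N - 1) 0) 0 0 G :=
    hG.mono hIco (uniqueDiffOn_Ico _ _)
  -- drift and kernel bounds below a negative time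
  have hdrift : ∀ {r : ℝ}, r < 0 → ∀ {e : ℝ}, 0 < e → e ≤ -r → ∀ x, ‖b r x‖ ≤ C₀ / Real.sqrt e := by
    intro r hr e he her x
    refine (hbI r hr x).trans ?_
    exact div_le_div_of_nonneg_left hC₀ (Real.sqrt_pos.2 he) (Real.sqrt_le_sqrt her)
  have hsup : ∀ {r : ℝ}, r < 0 → d ≤ -r → ∀ x, |G r x| ≤ M := by
    intro r hr hdr x
    rw [abs_of_pos (hG.pos r hr x)]
    refine (hGb r hr x).trans ?_
    have h1 : ((0:ℝ) - r) ^ (-(3:ℝ) / 2) ≤ d ^ (-(3:ℝ) / 2) :=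
      Real.rpow_le_rpow_of_nonpos hd0 (by linarith) (by norm_num)
    have h2 : Real.exp (-(‖x - (0 : (EuclideanSpace ℝ (Fin 3)))‖ ^ 2) / (C₂ * ((0:ℝ) - r))) ≤ 1 := by
      rw [Real.exp_le_one_iff, neg_div]
      exact neg_nonpos.2 (div_nonneg (sq_nonneg _) (mul_nonneg hC₂.le (by linarith)))
    have h3 : 0 ≤ C₁ * ((0:ℝ) - r) ^ (-(3:ℝ) / 2) :=
      mul_nonneg hC₁.le (Real.rpow_nonneg (by linarith) _)
    calc C₁ * ((0:ℝ) - r) ^ (-(3:ℝ) / 2) * Real.exp (-(‖x - (0 : (EuclideanSpace ℝ (Fin 3)))‖ ^ 2) / (C₂ * ((0:ℝ) - r)))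
        ≤ C₁ * ((0:ℝ) - r) ^ (-(3:ℝ) / 2) * 1 := mul_le_mul_of_nonneg_left h2 h3
      _ ≤ M := by rw [mul_one]; exact mul_le_mul_of_nonneg_left h1 hC₁.le
  -- ## the spatial modulus at every time of the piece
  have hspace : ∀ {r : ℝ}, -N ≤ r → r ≤ -(1 / N) → ∀ c y : (EuclideanSpace ℝ (Fin 3)), ‖y - c‖ ≤ δx →
      |G r y - G r c| ≤ η := by
    intro r hr1 hr2 c y hyc
    have hr0 : r < 0 := by
      have : (0:ℝ) < 1 / N := by positivity
      linarith
    have hrd : r + d < 0 := by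
      have : r + d ≤ -(1 / N) + d := by linarith
      linarith [hdN, hd0]
    have hblock : ∀ s ∈ Icc r (r + d), s < 0 ∧ d ≤ -s := fun s hs =>
      ⟨lt_of_le_of_lt hs.2 hrd, by linarith [hs.2, hdN]⟩
    have hBd' : ∀ s ∈ Icc r (r + d), ∀ x, ‖b s x‖ ≤ Bd := fun s hs x =>
      hdrift (hblock s hs).1 hd0 (hblock s hs).2 x
    have hGM : ∀ s ∈ Icc r (r + d), ∀ x, |G s x| ≤ M := fun s hs x =>
      hsup (hblock s hs).1 (hblock s hs).2 x
    exact stub_kernelLimit_spaceModulus 1 (-N - 1) 0 r d Bd M ρ η b 0 G c y one_pos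
      (by linarith) hd0 hrd hb' hBd' hBd0 hG' hM0 hGM hρ0 hρτ hη0 hyc
  -- ## the time modulus at every point, through the translated bump
  have htime : ∀ {r r' : ℝ}, -N ≤ r → r ≤ -(1 / N) → -N ≤ r' → r' ≤ -(1 / N) → ∀ p : (EuclideanSpace ℝ (Fin 3)),
      |G r p - G r' p| * I₀ ≤ 2 * (η * I₀) + |Lt| * |r - r'| := by
    intro r r' hr1 hr2 hr'1 hr'2 p
    have h1N : (0:ℝ) < 1 / N := by positivity
    have hr0 : r < 0 := by linarith
    have hr'0 : r' < 0 := by linarith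
    -- the translated bump
    set ψ : (EuclideanSpace ℝ (Fin 3)) → ℝ := fun y => ψ₀ (y + -p) with hψdef
    have hψ2 : ContDiff ℝ 2 ψ := hψ₀2.comp (contDiff_id.add contDiff_const)
    have hψcont : Continuous ψ := hψ2.continuous
    have hψc : HasCompactSupport ψ := by
      have e : ψ = ψ₀ ∘ Homeomorph.addRight (-p) := by
        funext y; simp [hψdef]
      rw [e]
      exact hψ₀c.comp_homeomorph _
    have hψ0 : ∀ y, 0 ≤ ψ y := fun y => hψ₀0 _
    have hψM₁ : ∀ x, ‖fderiv ℝ ψ x‖ ≤ M₁ := fun x => by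
      rw [hψdef, fderiv_comp_add_right]; exact hM₁ _
    have hψM₂ : ∀ x, |(Δ ψ) x| ≤ 3 * M₂' := fun x => by
      rw [hψdef, laplacian_comp_add_right]; exact hM₂ _
    have hψI : ∫ y, ψ y = I₀ := by
      rw [hI₀]; exact integral_add_right_eq_self (fun y => ψ₀ y) (-p)
    have hψsupp : ∀ y, ψ y ≠ 0 → ‖y - p‖ ≤ δx := fun y hy => by
      have h := hψ₀supp (y + -p) hy
      rw [← sub_eq_add_neg] at h
      exact h.le
    -- Lipschitz pairings
    have hbA : ∀ s ∈ Icc (-N) (-(1 / N)), ∀ x ∈ tsupport ψ, ‖b s x‖ ≤ A := fun s hs x _ =>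
      hdrift (by linarith [hs.2]) h1N (by linarith [hs.2]) x
    have hpair := kernelLimit_pairing_lipschitz (ν := 1) zero_le_one hb' hdiv' hG' hψ2 hψc
      (show -N - 1 < -N by linarith) (show -(1 / N) < (0:ℝ) by linarith) hA0 hbA hψM₁ hψM₂
      (s := r') (t := r) ⟨hr'1, hr'2⟩ ⟨hr1, hr2⟩
    -- the two bump estimates
    have hGr : Continuous (G r) := (hG.contDiff_slice hr0).continuous
    have hGr' : Continuous (G r') := (hG.contDiff_slice hr'0).continuous
    have hbr : |(∫ y, ψ y * G r y) - G r p * ∫ y, ψ y| ≤ η * ∫ y, ψ y :=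
      kernelLimit_abs_integral_mul_sub_le hψcont hψc hψ0 hGr fun y hy =>
        hspace hr1 hr2 p y (hψsupp y hy)
    have hbr' : |(∫ y, ψ y * G r' y) - G r' p * ∫ y, ψ y| ≤ η * ∫ y, ψ y :=
      kernelLimit_abs_integral_mul_sub_le hψcont hψc hψ0 hGr' fun y hy =>
        hspace hr'1 hr'2 p y (hψsupp y hy)
    rw [hψI] at hbr hbr'
    -- assemble
    have e : (G r p - G r' p) * I₀ = (G r p * I₀ - ∫ y, ψ y * G r y) +
        ((∫ y, ψ y * G r y) - ∫ y, ψ y * G r' y) + ((∫ y, ψ y * G r' y) - G r' p * I₀) := by ring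
    rw [← abs_of_pos hI₀0, ← abs_mul, e, abs_of_pos hI₀0]
    have hL : |(∫ y, ψ y * G r y) - ∫ y, ψ y * G r' y| ≤ |Lt| * |r - r'| :=
      hpair.trans (mul_le_mul_of_nonneg_right (le_abs_self _) (abs_nonneg _))
    rw [abs_sub_comm] at hbr
    calc |(G r p * I₀ - ∫ y, ψ y * G r y) + ((∫ y, ψ y * G r y) - ∫ y, ψ y * G r' y) +
          ((∫ y, ψ y * G r' y) - G r' p * I₀)|
        ≤ |(G r p * I₀ - ∫ y, ψ y * G r y) + ((∫ y, ψ y * G r y) - ∫ y, ψ y * G r' y)| +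
            |(∫ y, ψ y * G r' y) - G r' p * I₀| := abs_add_le _ _
      _ ≤ |G r p * I₀ - ∫ y, ψ y * G r y| + |(∫ y, ψ y * G r y) - ∫ y, ψ y * G r' y| +
            |(∫ y, ψ y * G r' y) - G r' p * I₀| := by
          gcongr
          exact abs_add_le _ _
      _ ≤ η * I₀ + |Lt| * |r - r'| + η * I₀ := by gcongr
      _ = 2 * (η * I₀) + |Lt| * |r - r'| := by ring
  -- ## conclusion
  obtain ⟨⟨hz1, hz2⟩, -⟩ := mem_slabPiece.1 hz
  obtain ⟨⟨hz'1, hz'2⟩, -⟩ := mem_slabPiece.1 hz'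
  have hdt : |z.1 - z'.1| ≤ dist z z' := by
    rw [← Real.dist_eq, Prod.dist_eq]; exact le_max_left _ _
  have hdx : ‖z.2 - z'.2‖ ≤ dist z z' := by
    rw [← dist_eq_norm, Prod.dist_eq]; exact le_max_right _ _
  have hδ1 : dist z z' ≤ δx := hzz'.trans (min_le_left _ _)
  have hδ2 : dist z z' ≤ η * I₀ / (|Lt| + 1) := hzz'.trans (min_le_right _ _)
  -- time step at the point `z.2`
  have h1 : |G z.1 z.2 - G z'.1 z.2| ≤ 3 * η := by
    have key := htime hz1 hz2 hz'1 hz'2 z.2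
    have hL1 : 0 < |Lt| + 1 := by positivity
    have hsmall : |Lt| * |z.1 - z'.1| ≤ η * I₀ := by
      calc |Lt| * |z.1 - z'.1| ≤ |Lt| * (η * I₀ / (|Lt| + 1)) :=
            mul_le_mul_of_nonneg_left (hdt.trans hδ2) (abs_nonneg _)
        _ ≤ (|Lt| + 1) * (η * I₀ / (|Lt| + 1)) :=
            mul_le_mul_of_nonneg_right (by linarith) (by positivity)
        _ = η * I₀ := by field_simp
    have h3 : |G z.1 z.2 - G z'.1 z.2| * I₀ ≤ (3 * η) * I₀ := by nlinarith
    exact le_of_mul_le_mul_right h3 hI₀0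
  -- space step at the time `z'.1`
  have h2 : |G z'.1 z.2 - G z'.1 z'.2| ≤ η := by
    have h := hspace hz'1 hz'2 z.2 z'.2 (by rw [norm_sub_rev]; exact hdx.trans hδ1)
    rwa [abs_sub_comm] at h
  calc |G z.1 z.2 - G z'.1 z'.2| = |(G z.1 z.2 - G z'.1 z.2) + (G z'.1 z.2 - G z'.1 z'.2)| := by ring_nf
    _ ≤ |G z.1 z.2 - G z'.1 z.2| + |G z'.1 z.2 - G z'.1 z'.2| := abs_add_le _ _
    _ ≤ 3 * η + η := add_le_add h1 h2
    _ = ε := by rw [hη]; ring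

/-- **Registered sub-goal `adaptedKernel_slabPiece_modulus`** (part 1 of the proof of STUB
`stub_pinchedHullRecurrence`; the statement of `adaptedKernel_slabPiece_modulus'` with the binders
spelled out): joint equicontinuity on the slab pieces of adapted backward kernels of Type-I drifts
with common constants. [folklore] -/
theorem adaptedKernel_slabPiece_modulus : ∀ {C₀ C₁ C₂ : ℝ}, 0 ≤ C₀ → 0 < C₁ → 0 < C₂ → ∀ (n : ℕ) {ε : ℝ}, 0 < ε → ∃ δ : ℝ, 0 < δ ∧ ∀ (b : ℝ → EuclideanSpace ℝ (Fin 3) → EuclideanSpace ℝ (Fin 3)) (G : ℝ → EuclideanSpace ℝ (Fin 3) → ℝ), Literature.Analysis.FluidPDE.IsSmoothSpaceTimeOn (Set.Iio 0) b → (∀ t ∈ Set.Iio (0:ℝ), Literature.Analysis.FluidPDE.VectorCalculus.IsDivFree (b t)) → (∀ t ∈ Set.Iio (0:ℝ), ∀ x, ‖b t x‖ ≤ C₀ / Real.sqrt (-t)) → Literature.Analysis.FluidPDE.IsAdaptedBackwardKernel 1 b (Set.Iio 0) 0 0 G → (∀ t ∈ Set.Iio (0:ℝ), ∀ x, G t x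 ≤ C₁ * ((0:ℝ) - t) ^ (-(3:ℝ) / 2) * Real.exp (-(‖x - (0 : EuclideanSpace ℝ (Fin 3))‖ ^ 2) / (C₂ * ((0:ℝ) - t)))) → ∀ z ∈ Set.Icc (-((n : ℝ) + 2)) (-(1 / ((n : ℝ) + 2))) ×ˢ Metric.closedBall (0 : EuclideanSpace ℝ (Fin 3)) ((n : ℝ) + 2), ∀ z' ∈ Set.Icc (-((n : ℝ) + 2)) (-(1 / ((n : ℝ) + 2))) ×ˢ Metric.closedBall (0 : EuclideanSpace ℝ (Fin 3)) ((n : ℝ) + 2), dist z z' ≤ δ → |G z.1 z.2 - G z'.1 z'.2| ≤ ε :=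
  fun hC₀ hC₁ hC₂ n _ hε => adaptedKernel_slabPiece_modulus' hC₀ hC₁ hC₂ n hε

/-- **Pointwise ⟹ uniform on the slab pieces, for adapted kernels of Type-I drifts with common
constants**: a sequence of adapted backward kernels (unit viscosity, pole `(0,0)`, on `(−∞,0)`) of
jointly smooth divergence-free drifts with ONE Type-I constant, under ONE Gaussian upper bound,
which converges at every point of the open slab converges uniformly on every slab piece
(`adaptedKernel_slabPiece_modulus'` + `tendstoUniformlyOn_of_uniform_modulus`). [folklore] -/
theorem tendstoUniformlyOn_slabPiece_of_adaptedKernels {C₀ C₁ C₂ : ℝ} (hC₀ : 0 ≤ C₀) (hC₁ : 0 < C₁)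
    (hC₂ : 0 < C₂)
    {b : ℕ → ℝ → (EuclideanSpace ℝ (Fin 3)) → (EuclideanSpace ℝ (Fin 3))}
    {g : ℕ → ℝ → (EuclideanSpace ℝ (Fin 3)) → ℝ}
    (hb : ∀ k, IsSmoothSpaceTimeOn (Iio 0) (b k))
    (hdiv : ∀ k, ∀ t ∈ Iio (0:ℝ), VectorCalculus.IsDivFree (b k t))
    (hI : ∀ k, ∀ t ∈ Iio (0:ℝ), ∀ x, ‖b k t x‖ ≤ C₀ / Real.sqrt (-t))
    (hg : ∀ k, IsAdaptedBackwardKernel 1 (b k) (Iio 0) 0 0 (g k))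
    (hgb : ∀ k, ∀ t ∈ Iio (0:ℝ), ∀ x, g k t x ≤ C₁ * ((0:ℝ) - t) ^ (-(3:ℝ) / 2) *
      Real.exp (-(‖x - (0 : (EuclideanSpace ℝ (Fin 3)))‖ ^ 2) / (C₂ * ((0:ℝ) - t))))
    {K : ℝ → (EuclideanSpace ℝ (Fin 3)) → ℝ}
    (hgK : ∀ t < 0, ∀ x, Tendsto (fun k => g k t x) atTop (𝓝 (K t x))) (n : ℕ) :
    TendstoUniformlyOn (fun k z => g k z.1 z.2) (fun z => K z.1 z.2) atTop
      (Icc (-((n : ℝ) + 2)) (-(1 / ((n : ℝ) + 2))) ×ˢ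
        closedBall (0 : (EuclideanSpace ℝ (Fin 3))) ((n : ℝ) + 2)) := by
  refine tendstoUniformlyOn_of_uniform_modulus (isCompact_slabPiece n) (fun ε hε => ?_)
    (fun z hz => hgK z.1 (neg_of_mem_slabPiece hz) z.2)
  obtain ⟨δ, hδ, hmod⟩ := adaptedKernel_slabPiece_modulus' hC₀ hC₁ hC₂ n hε
  exact ⟨δ, hδ, fun j z hz z' hz' hd => hmod (b j) (g j) (hb j) (hdiv j) (hI j) (hg j) (hgb j) z hz z' hz' hd⟩

end Summit.NavierStokesRegularity.NavierStokesRegularity.Theorems.AdaptedFrequencyConverges.BirkhoffRecurrentHull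

end
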